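import Literature.NumberTheory.GaloisRepresentations.GL2ModFourFullOrNormaliserProofs
import HarnessLib

/-!
# The trace–determinant certificate for surjectivity modulo `4` (proofs only)

Sorry-free `Proofs` companion (theorems only, no new definitions or facts; D-0014/D-0026) of
`GL2ModFourFullOrNormaliserProofs`.  There, following T. Dokchitser, V. Dokchitser, *Surjectivity of
mod `2ⁿ` representations of elliptic curves*, Math. Z. 272 (2012) 961–964, proof of Theorem (2), a
homomorphism `ρ : G →* M₂(ℤ/4ℤ)` with full reduction modulo `2` (L2) and both quadratic characters
`χ₋₁ ∘ det`, `(χ₋₁ ∘ det)·sgn` nontrivial (W1, W2) is either onto `GL₂(ℤ/4ℤ)` or has a conjugate of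
its image inside `ℍ = GL2Mod4.HH`, the normaliser of the non-split Cartan (Dokchitser–Dokchitser's
`ℍ = ⟨(0 1; 3 0), (0 1; 1 1)⟩`, index `4`).

Here we record the conjugation invariants of `ℍ` (kernel check, `HH_trace_det_table`): the pairs
`(tr h, det h)`, `h ∈ ℍ`, are exactly `(0,1), (0,3), (1,1), (1,3), (2,1), (3,1), (3,3)` — of the eight
pairs attained on `GL₂(ℤ/4ℤ)` the pair `(2, 3)` is MISSING (it is attained by `24` elements of
`GL₂(ℤ/4ℤ)`, e.g. `(0 1; 1 2)`, `trace_two_det_three_witness`; the other seven occur,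
`HH_trace_det_witnesses`), and with the sign of the reduction
added so is `(tr, det, sgn) = (2, 1, odd)`.  Consequently (`surjective_of_trace_two_det_three`,
`surjective_of_trace_two_det_one_of_sg`): under (L2), (W1), (W2), ONE value `ρ σ` with
`tr ρ σ = 2`, `det ρ σ = 3` in `ℤ/4ℤ` (or with `tr = 2`, `det = 1` and odd reduction) forces
`Im ρ = GL₂(ℤ/4ℤ)`.  (For an elliptic curve over `ℚ` with `ρ̄₂` onto and `Δ ∉ -ℚ^{×2}` this is the
certificate "one good prime `p ≡ 3 (mod 4)` with `a_p ≡ 2 (mod 4)`", once the consumer supplies the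
Frobenius trace/determinant compatibility — not part of this file.)

## References

* [DokchitserDokchitserMathZ2012] T. Dokchitser, V. Dokchitser, Math. Z. 272 (2012) 961–964,
  proof of the Theorem, clause (2) (the subgroup `ℍ`). [corpus:paper:arxiv-1104.5031 p0001 L99–L104]
-/

set_option autoImplicit false

namespace Literature.NumberTheory.GaloisRepresentations.GL2Mod4

open Matrix
open Literature.NumberTheory.GaloisRepresentations.GL2Mod8 (P4 P4.mul P4.det eps)

variable {G : Type*} [Group G] (ρ : G →* M4)

/-! ### §1. The conjugation invariants of `ℍ` -/

set_option maxRecDepth 100000 in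
set_option maxHeartbeats 0 in
/-- **The `(trace, det)` table of `ℍ`**: no element of `ℍ` has `(tr, det) = (2, 3)`, and none has
`(tr, det) = (2, 1)` with odd reduction modulo `2` (kernel check over the `24` elements).
[cite: DokchitserDokchitserMathZ2012, proof of Theorem (2) (the subgroup ℍ of index 4)] -/
theorem HH_trace_det_table : ∀ h : Q4, h ∈ HH →
    ¬(h.1 + h.2.2.2 = 2 ∧ Q4.det h = 3) ∧ ¬(h.1 + h.2.2.2 = 2 ∧ Q4.det h = 1 ∧ eps (Q4.par h) = 1) := by
  decide +kernel

set_option maxRecDepth 100000 in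
set_option maxHeartbeats 0 in
/-- The excluded pair `(2, 3)` occurs on `GL₂(ℤ/4ℤ)`: `(0 1; 1 2)` has trace `2`, determinant `3` and
lies outside `ℍ`. [cite: DokchitserDokchitserMathZ2012, proof of Theorem (2) (the subgroup ℍ of index 4)] -/
theorem trace_two_det_three_witness : ((0, 1, 1, 2) : Q4).1 + ((0, 1, 1, 2) : Q4).2.2.2 = 2 ∧
    Q4.det (0, 1, 1, 2) = 3 ∧ ((0, 1, 1, 2) : Q4) ∉ HH := by
  decide +kernel

set_option maxRecDepth 100000 in
set_option maxHeartbeats 0 in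
/-- The seven other pairs `(tr, det) = (0,1), (0,3), (1,1), (1,3), (2,1), (3,1), (3,3)` DO occur on
`ℍ`: one witness each, in this order.
[cite: DokchitserDokchitserMathZ2012, proof of Theorem (2) (the subgroup ℍ of index 4)] -/
theorem HH_trace_det_witnesses :
    ∀ h ∈ ({(0, 1, 3, 0), (1, 0, 1, 3), (2, 1, 1, 3), (0, 1, 1, 1), (1, 0, 0, 1), (1, 1, 1, 2),
      (0, 3, 3, 3)} : Finset Q4), h ∈ HH := by
  decide +kernel

/-! ### §2. Trace, determinant and sign are conjugation invariants -/

/-- `tr (k g k⁻¹) = tr g`. [cite: DokchitserDokchitserMathZ2012, proof of Theorem (2) (computation in GL₂(ℤ/4ℤ))] -/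
theorem trace_conj {k : M4} (hk : k.det * k.det = 1) (g : M4) :
    (k * g * inv' k).trace = g.trace := by
  rw [mul_assoc, Matrix.trace_mul_comm, mul_assoc, inv'_mul hk, mul_one]

/-- `det (k g k⁻¹) = det g`. [cite: DokchitserDokchitserMathZ2012, proof of Theorem (2) (computation in GL₂(ℤ/4ℤ))] -/
theorem det_conj {k : M4} (hk : k.det * k.det = 1) (g : M4) : (k * g * inv' k).det = g.det := by
  have h1 : k.det * (inv' k).det = 1 := by rw [← Matrix.det_mul, mul_inv' hk, Matrix.det_one]
  rw [Matrix.det_mul, Matrix.det_mul, mul_right_comm, h1, one_mul]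

/-- `sg 1 = 0`. [cite: DokchitserDokchitserMathZ2012, proof of Theorem (2) (computation in GL₂(ℤ/4ℤ))] -/
theorem sg_one : sg (1 : M4) = 0 := by decide

/-- `sgn` of the reduction is a conjugation invariant: `sg (k g k⁻¹) = sg g`.
[cite: DokchitserDokchitserMathZ2012, proof of Theorem (2) (computation in GL₂(ℤ/4ℤ))] -/
theorem sg_conj {k : M4} (hk : k.det * k.det = 1) {g : M4} (hg : g.det * g.det = 1) :
    sg (k * g * inv' k) = sg g := by
  have hι := det_inv'_mul_self hk
  have hkg : (k * g).det * (k * g).det = 1 := by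
    rw [Matrix.det_mul, mul_mul_mul_comm, hk, hg, one_mul]
  have h2 : sg k + sg (inv' k) = 0 := by rw [← sg_mul hk hι, mul_inv' hk, sg_one]
  rw [sg_mul hkg hι, sg_mul hk hg]
  linear_combination h2

/-! ### §3. The certificates -/

/-- **Trace–determinant certificate.**  Under (L2) full reduction modulo `2`, (W1) `χ₋₁ ∘ det`
nontrivial and (W2) `(χ₋₁ ∘ det)·sgn` nontrivial on the image, one value `ρ σ` with `tr (ρ σ) = 2`
and `det (ρ σ) = 3` (in `ℤ/4ℤ`) forces `ρ` onto `GL₂(ℤ/4ℤ)`: such an element lies in no conjugate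
of `ℍ` (`HH_trace_det_table`), so the second alternative of `surjective_or_conj_subset_HH` is void.
[cite: DokchitserDokchitserMathZ2012, proof of Theorem (2) (the subgroup ℍ of index 4)] -/
theorem surjective_of_trace_two_det_three
    (hL2 : ∀ p : P4, P4.det p = 1 → ∃ σ : G, par (ρ σ) = p)
    (h₁ : ∃ σ : G, cm1 (ρ σ).det = 1) (h₂ : ∃ σ : G, cm1 (ρ σ).det + sg (ρ σ) = 1)
    (h₃ : ∃ σ : G, (ρ σ).trace = 2 ∧ (ρ σ).det = 3) (g : M4) (hg : g.det * g.det = 1) :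
    ∃ σ : G, ρ σ = g := by
  rcases surjective_or_conj_subset_HH ρ hL2 h₁ h₂ with h | ⟨k, hk, hH⟩
  · exact h g hg
  · exfalso
    obtain ⟨σ, htr, hdet⟩ := h₃
    refine (HH_trace_det_table _ (hH σ)).1 ⟨?_, ?_⟩
    · show (k * ρ σ * inv' k) 0 0 + (k * ρ σ * inv' k) 1 1 = 2
      rw [← Matrix.trace_fin_two, trace_conj hk, htr]
    · rw [← det_eq, det_conj hk, hdet]

/-- **Trace–determinant–sign certificate.**  Under (L2), (W1), (W2), one value `ρ σ` with
`tr (ρ σ) = 2`, `det (ρ σ) = 1` and odd reduction (`sg (ρ σ) = 1`: `ρ σ mod 2` is a transposition of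
the three points of order `2`) forces `ρ` onto `GL₂(ℤ/4ℤ)`.
[cite: DokchitserDokchitserMathZ2012, proof of Theorem (2) (the subgroup ℍ of index 4)] -/
theorem surjective_of_trace_two_det_one_of_sg
    (hL2 : ∀ p : P4, P4.det p = 1 → ∃ σ : G, par (ρ σ) = p)
    (h₁ : ∃ σ : G, cm1 (ρ σ).det = 1) (h₂ : ∃ σ : G, cm1 (ρ σ).det + sg (ρ σ) = 1)
    (h₃ : ∃ σ : G, (ρ σ).trace = 2 ∧ (ρ σ).det = 1 ∧ sg (ρ σ) = 1) (g : M4)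
    (hg : g.det * g.det = 1) : ∃ σ : G, ρ σ = g := by
  rcases surjective_or_conj_subset_HH ρ hL2 h₁ h₂ with h | ⟨k, hk, hH⟩
  · exact h g hg
  · exfalso
    obtain ⟨σ, htr, hdet, hsg⟩ := h₃
    refine (HH_trace_det_table _ (hH σ)).2 ⟨?_, ?_, ?_⟩
    · show (k * ρ σ * inv' k) 0 0 + (k * ρ σ * inv' k) 1 1 = 2
      rw [← Matrix.trace_fin_two, trace_conj hk, htr]
    · rw [← det_eq, det_conj hk, hdet]
    · show sg (k * ρ σ * inv' k) = 1
      rw [sg_conj hk (det_sq ρ σ).1, hsg]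

end Literature.NumberTheory.GaloisRepresentations.GL2Mod4
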